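import Summits.ResolutionOfSingularities.ResolutionOfSingularities.Theorems.PurelyInseparableDim4SwapTransportWindowFrame
import HarnessLib
import HarnessLib.Audit.Tags

/-!
# Purely inseparable four-folds — ONE STEP OF THE VIRTUAL WINDOW: a real slot step / a real ROTATION of the C∞ chain is
# shadowed by a PURE slot step of the framed virtual partner (cell `res-dim4-pi`, K2(p) lane, slice B; K24b-R1 `virtual_step`)

[OURS · counted 0 · cell `res-dim4-pi` · K2(p) lane holder's ruling 2026-08-29 04:33:16Z (K24b-R1 (b), res-dim4-typ-1 g3); the
two foreign inputs are taken BY VALUE as hypotheses here — (VT-u) two-state (res-dim4-p-2 g5's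
`ResCone.cInf_translation_u_eq_zero_twoState`) and the `e_G` transfer through the slot-unit class (res-dim4-p-7 g4's
`SwapNorm.finrank_resVertex_eq_of_slotUnit_rel₂`) — and discharged in the sequel file.]  Nothing here proves K2(p)/K2(5),
`NoIsolatedTrap 5 5` or resolution of singularities in dimension ≥ 4 / characteristic `p` — NOT proved.  AI kernel work,
weaker than expert review.

* §1 **`virtual_step_slot`**: REAL state `A` (ledger `x_{πλ} x_{πμ}`, order 6) with its honest child
  `A′ = step 5 univ (π λ) b A` in the chart of the SLOT `π λ` (isolated with certificate level `Nc`, order 6, `e_G = 3`,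
  weights `≤ 1` of total 2, `x^{r′} ∣ F′`); VIRTUAL framed state `B` (fixed letters `λ μ | u f`: ledger `x_λ x_μ`, order 6,
  `x^r ∣ F`, straight residual `a·x_f⁴`, exact pair ledger, dead `ū²`-row below `N ≥ 12`, flag `V ≠ 0`) related to `A` by a
  slot-unit-class frame `θ` along `π` at precision `M ≥ Nc + 12` with invertible free block.  THEN `b (π μ) = 0`, and the
  pure slot step `B⁺ := step 5 univ λ 0 B` is related to `A′` along the same `π` at precision `M − 5` with invertible free
  block, framed again at jet `N − 4`, isolated with `e_G = 3`.  Route: kept slot from the weights (`step_cases_of_weights`) ⇒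
  Cramer (`exists_virtual_translation_step`) ⇒ `unitFrame_step₂` ⇒ `det_after_step` ⇒ `read_of_rel₂` ⇒ `e_G` by value ⇒
  (VT) `translation_eq_zero_of_frame` ⇒ `frame_step_zero`.  (The μ-chart case is the same statement with `λ ↔ μ`.)
* §2 **`virtual_step_rotate`**: the real chain steps in the chart of a FREE letter `π g` translating the slot `π a` away
  (`b (π a) ≠ 0`, `b (π a′) = 0`); the virtual partner steps purely in the chart of `a` and the bijection becomes
  `π′ = π ∘ (a g)`.  Route: Cramer (`exists_virtual_translation_rotate`) ⇒ `unitFrame_rotate₂` ⇒ `det_after_rotate` ⇒ as in §1.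
bears_on: LADDER-RESOLUTION:D157-DOOR2 (res-dim4-pi · K2(p) · slice B · K24b-R1).  Supports stmt-ResolutionOfSingularities-16155
(helper).
-/

set_option linter.dupNamespace false -- mandated namespace of this single-conjunct summit

noncomputable section

namespace Summit.ResolutionOfSingularities.ResolutionOfSingularities.Theorems.PIDim4

namespace SwapTransport

open MvPolynomial Finset
open Literature.AlgebraicGeometry.Resolution
open Literature.AlgebraicGeometry.Resolution.CentreBlowup
open Literature.AlgebraicGeometry.Resolution.Hauser2010
open Literature.AlgebraicGeometry.Resolution.HauserPerlega2019

variable {K : Type} [Field K] [CharP K 5] [DecidableEq K]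

/-! ## §1 One window step, slot case -/

/-- **ONE STEP OF THE VIRTUAL WINDOW — SLOT CASE** (module docstring §1; the two foreign facts `hVTu`, `hEG` are hypotheses
BY VALUE). [OURS] [cite: Hauser2010, §§F–G] [cite: CossartJannsenSaito2020, Thm. 3.14] -/
theorem virtual_step_slot {π : Equiv.Perm (Fin 4)} {la mu u f : Fin 4} (hlm : la ≠ mu) (hlu : la ≠ u) (hlf : la ≠ f)
    (hmu : mu ≠ u) (hmf : mu ≠ f) (huf : u ≠ f)
    -- the relation at precision `M`
    {A B : State K} {θ e : Fin 4 → MvPolynomial (Fin 4) K} {U E : MvPolynomial (Fin 4) K} {M : ℕ}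
    (hθa : θ (π la) = X la * e la) (hθa' : θ (π mu) = X mu * e mu) (hea : constantCoeff (e la) ≠ 0)
    (hea' : constantCoeff (e mu) ≠ 0) (hu0 : constantCoeff (θ (π u)) = 0) (hf0 : constantCoeff (θ (π f)) = 0)
    (hdet : coeff (Finsupp.single u 1) (θ (π u)) * coeff (Finsupp.single f 1) (θ (π f)) -
      coeff (Finsupp.single f 1) (θ (π u)) * coeff (Finsupp.single u 1) (θ (π f)) ≠ 0)
    (hU : constantCoeff U ≠ 0) (hE : E ∈ originIdeal K ^ M) (hrel : B.F = deletePthPowers 5 (U ^ 5 * aeval θ A.F) + E)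
    -- the real state and its honest slot step
    (hoA : ordZero A.F = 6) (hrA : A.r = Finsupp.single (π la) 1 + Finsupp.single (π mu) 1) {A' : State K}
    {b : Fin 4 → K} (hbj : b (π la) = 0) (hstep : A' = CentreBlowup.step 5 Finset.univ (π la) b A)
    (hisoA' : IsIsolated 5 A'.F) {Nc : ℕ} (hcert : originIdeal K ^ Nc ≤ singLocusIdeal 5 A'.F ⊔ originIdeal K ^ (Nc + 1))
    (hoA' : ordZero A'.F = 6) (he3A' : Module.finrank K (ResCone.resVertex A') = 3) (hw1 : ∀ i, A'.r i ≤ 1)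
    (hdegA' : A'.r.degree = 2) (hdivA' : ∀ d ∈ A'.F.support, A'.r ≤ d)
    -- the virtual frame at jet `N`
    (hoB : ordZero B.F = 6) (hrB : B.r = Finsupp.single la 1 + Finsupp.single mu 1) (hdivB : ∀ d ∈ B.F.support, B.r ≤ d)
    {a : K} (ha : a ≠ 0) (hformB : ResCone.resForm B = C a * X f ^ 4)
    (hledB : ∀ e ∈ B.F.support, e f ≤ 3 → 2 ≤ e la ∧ 2 ≤ e mu) {N : ℕ} (hN : 12 ≤ N)
    (hrowB : ∀ d ∈ B.F.support, d.degree < N → ¬ (d u = 2 ∧ d f = 0))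
    (hVB : coeff (B.r + (Finsupp.single la 1 + Finsupp.single mu 1 + Finsupp.single u 3)) B.F ≠ 0)
    (hM : Nc + 12 ≤ M)
    -- (VT-u) two-state, BY VALUE (res-dim4-p-2 g5)
    (hVTu : ∀ (s : State K) (β : K), s.r = Finsupp.single la 1 + Finsupp.single mu 1 → ordZero s.F = 6 →
      (∀ e ∈ s.F.support, s.r ≤ e) → (∃ a : K, a ≠ 0 ∧ ResCone.resForm s = C a * X f ^ 4) →
      (∀ e ∈ s.F.support, e f ≤ 3 → 2 ≤ e la ∧ 2 ≤ e mu) →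
      (∀ d ∈ s.F.support, d.degree < 8 → ¬ (d u = 2 ∧ d f = 0)) →
      coeff (s.r + (Finsupp.single la 1 + Finsupp.single mu 1 + Finsupp.single u 3)) s.F ≠ 0 →
      ordZero (CentreBlowup.step 5 Finset.univ la (Pi.single u β) s).F = 6 →
      Module.finrank K (ResCone.resVertex (CentreBlowup.step 5 Finset.univ la (Pi.single u β) s)) = 3 → β = 0)
    -- `e_G` through the relation, BY VALUE (res-dim4-p-7 g4)
    (hEG : ∀ (A₁ B₁ : State K) (θ₁ e₁ : Fin 4 → MvPolynomial (Fin 4) K) (U₁ E₁ : MvPolynomial (Fin 4) K) (M₁ : ℕ),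
      θ₁ (π la) = X la * e₁ la → θ₁ (π mu) = X mu * e₁ mu → constantCoeff (e₁ la) ≠ 0 → constantCoeff (e₁ mu) ≠ 0 →
      constantCoeff (θ₁ (π u)) = 0 → constantCoeff (θ₁ (π f)) = 0 →
      coeff (Finsupp.single u 1) (θ₁ (π u)) * coeff (Finsupp.single f 1) (θ₁ (π f)) -
        coeff (Finsupp.single f 1) (θ₁ (π u)) * coeff (Finsupp.single u 1) (θ₁ (π f)) ≠ 0 →
      constantCoeff U₁ ≠ 0 → E₁ ∈ originIdeal K ^ M₁ → B₁.F = deletePthPowers 5 (U₁ ^ 5 * aeval θ₁ A₁.F) + E₁ →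
      A₁.r = Finsupp.single (π la) 1 + Finsupp.single (π mu) 1 → B₁.r = Finsupp.single la 1 + Finsupp.single mu 1 →
      (∀ d ∈ A₁.F.support, A₁.r ≤ d) → (∀ d ∈ B₁.F.support, B₁.r ≤ d) → ordZero A₁.F = 6 → ordZero B₁.F = 6 → 6 < M₁ →
      Module.finrank K (ResCone.resVertex B₁) = Module.finrank K (ResCone.resVertex A₁)) :
    b (π mu) = 0 ∧ A'.r = Finsupp.single (π la) 1 + Finsupp.single (π mu) 1 ∧
    ∃ (θ' e' : Fin 4 → MvPolynomial (Fin 4) K) (U' E' : MvPolynomial (Fin 4) K),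
      θ' (π la) = X la * e' la ∧ θ' (π mu) = X mu * e' mu ∧ constantCoeff (e' la) ≠ 0 ∧ constantCoeff (e' mu) ≠ 0 ∧
      constantCoeff (θ' (π u)) = 0 ∧ constantCoeff (θ' (π f)) = 0 ∧
      coeff (Finsupp.single u 1) (θ' (π u)) * coeff (Finsupp.single f 1) (θ' (π f)) -
        coeff (Finsupp.single f 1) (θ' (π u)) * coeff (Finsupp.single u 1) (θ' (π f)) ≠ 0 ∧
      constantCoeff U' ≠ 0 ∧ E' ∈ originIdeal K ^ (M - 5) ∧
      (CentreBlowup.step 5 Finset.univ la 0 B).F = deletePthPowers 5 (U' ^ 5 * aeval θ' A'.F) + E' ∧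
      -- the frame of the virtual child at jet `N − 4`
      ordZero (CentreBlowup.step 5 Finset.univ la 0 B).F = 6 ∧
      (CentreBlowup.step 5 Finset.univ la 0 B).r = Finsupp.single la 1 + Finsupp.single mu 1 ∧
      (∀ d ∈ (CentreBlowup.step 5 Finset.univ la 0 B).F.support, (CentreBlowup.step 5 Finset.univ la 0 B).r ≤ d) ∧
      (∃ a' : K, a' ≠ 0 ∧ ResCone.resForm (CentreBlowup.step 5 Finset.univ la 0 B) = C a' * X f ^ 4) ∧
      (∀ e ∈ (CentreBlowup.step 5 Finset.univ la 0 B).F.support, e f ≤ 3 → 2 ≤ e la ∧ 2 ≤ e mu) ∧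
      (∀ d ∈ (CentreBlowup.step 5 Finset.univ la 0 B).F.support, d.degree < N - 4 → ¬ (d u = 2 ∧ d f = 0)) ∧
      coeff ((CentreBlowup.step 5 Finset.univ la 0 B).r + (Finsupp.single la 1 + Finsupp.single mu 1 + Finsupp.single u 3))
        (CentreBlowup.step 5 Finset.univ la 0 B).F ≠ 0 ∧
      IsIsolated 5 (CentreBlowup.step 5 Finset.univ la 0 B).F ∧
      Module.finrank K (ResCone.resVertex (CentreBlowup.step 5 Finset.univ la 0 B)) = 3 := by
  haveI : Fact (Nat.Prime 5) := ⟨by norm_num⟩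
  have hπlm : π la ≠ π mu := fun h => hlm (π.injective h)
  have hπlu : π la ≠ π u := fun h => hlu (π.injective h)
  have hπlf : π la ≠ π f := fun h => hlf (π.injective h)
  have hπmu : π mu ≠ π u := fun h => hmu (π.injective h)
  have hπmf : π mu ≠ π f := fun h => hmf (π.injective h)
  have hπuf : π u ≠ π f := fun h => huf (π.injective h)
  -- (1) the kept slot: `b (π mu) = 0`, `A′.r = x_{πλ} x_{πμ}`
  have hw1' : ∀ i, (CentreBlowup.step 5 Finset.univ (π la) b A).r i ≤ 1 := fun i => by rw [← hstep]; exact hw1 i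
  have hdeg' : (CentreBlowup.step 5 Finset.univ (π la) b A).r.degree = 2 := by rw [← hstep]; exact hdegA'
  have hkept : b (π mu) = 0 ∧ A'.r = Finsupp.single (π la) 1 + Finsupp.single (π mu) 1 := by
    rcases step_cases_of_weights hπlm hπlu hπlf hπmu hπmf hπuf hrA hoA (jr := π la) hw1' hdeg' with
      ⟨-, hb, hr⟩ | ⟨h, -⟩ | ⟨h, -⟩
    · exact ⟨hb, by rw [hstep, hr]⟩
    · exact absurd h hπlm
    · rcases h with h | h
      · exact absurd h hπlu
      · exact absurd h hπlf
  obtain ⟨hbmu, hrA'⟩ := hkept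
  -- (2) the class hypotheses in `∀ i ∉ {u, f}` form
  have hslots : ∀ i : Fin 4, i ≠ u → i ≠ f → i = la ∨ i = mu := by
    intro i hiu hif
    rcases ResCone.letters_exhaust hlm hlu hlf hmu hmf huf i with h | h | h | h
    · exact Or.inl h
    · exact Or.inr h
    · exact absurd h hiu
    · exact absurd h hif
  have hθi : ∀ i, i ≠ u → i ≠ f → θ (π i) = X i * e i := by
    intro i hiu hif; rcases hslots i hiu hif with rfl | rfl <;> assumption
  have he : ∀ i, i ≠ u → i ≠ f → constantCoeff (e i) ≠ 0 := by
    intro i hiu hif; rcases hslots i hiu hif with rfl | rfl <;> assumption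
  have hbi : ∀ i, i ≠ u → i ≠ f → b (π i) = 0 := by
    intro i hiu hif; rcases hslots i hiu hif with rfl | rfl <;> assumption
  -- (3) Cramer: the virtual translation
  obtain ⟨b', hb'i, hγu, hγf⟩ := exists_virtual_translation_step (π := π) (θ := θ) (e := e) la huf b hdet
  have hA5 : ((5 : ℕ) : ℕ∞) ≤ ordAlong Finset.univ A.F := by rw [ordAlong_univ, hoA]; exact_mod_cast (by norm_num : 5 ≤ 6)
  have hB5 : ((5 : ℕ) : ℕ∞) ≤ ordAlong Finset.univ B.F := by rw [ordAlong_univ, hoB]; exact_mod_cast (by norm_num : 5 ≤ 6)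
  -- (4) transport
  obtain ⟨θ', e', U', E', w, hθ'i, he', hu0', hf0', hU', hE', hrel', hwc, -, -, hlinu, hlinf⟩ :=
    unitFrame_step₂ 5 π huf hθi he hu0 hf0 hU hE hrel hA5 hB5 hlu hlf hbi hb'i hγu hγf
  rw [← hstep] at hrel'
  have hwne : w ≠ 0 := left_ne_zero_of_mul_eq_one hwc
  -- (5) the new free block is invertible
  have hdet' : coeff (Finsupp.single u 1) (θ' (π u)) * coeff (Finsupp.single f 1) (θ' (π f)) -
      coeff (Finsupp.single f 1) (θ' (π u)) * coeff (Finsupp.single u 1) (θ' (π f)) ≠ 0 := by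
    rw [det_after_step hlu hlf hlinu hlinf]
    exact mul_ne_zero (pow_ne_zero 2 hwne) hdet
  -- (6) order and isolation of the virtual child
  set Bp := CentreBlowup.step 5 Finset.univ la b' B with hBp
  have hread := read_of_rel₂ 5 hlm hlu hlf hmu hmf huf (hθ'i la hlu hlf) (hθ'i mu hmu hmf) (he' la hlu hlf)
    (he' mu hmu hmf) hu0' hf0' hdet' hU' hE' hrel' hisoA' hcert (by omega) (o := 6) hoA' (by norm_num) (by omega)
  have hisoBp : IsIsolated 5 Bp.F := hread.1
  have hoBp : ordZero Bp.F = 6 := by exact_mod_cast hread.2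
  -- (7) ledger and divisibility of the virtual child, then `e_G` by value
  have hb'la : b' la = 0 := hb'i la hlu hlf
  have hb'mu : b' mu = 0 := hb'i mu hmu hmf
  have hrBp : Bp.r = Finsupp.single la 1 + Finsupp.single mu 1 := by
    obtain ⟨-, h2, h3, h4⟩ := ResCone.quad_apply hlm hlu hlf hmu hmf huf 1 1 0 0
    have hrB4 : B.r = Finsupp.single la 1 + Finsupp.single mu 1 + Finsupp.single u 0 + Finsupp.single f 0 := by
      rw [hrB, Finsupp.single_zero, Finsupp.single_zero, add_zero, add_zero]
    rw [ResCone.eq_sum_single_four hlm hlu hlf hmu hmf huf Bp.r, hBp, step_r_apply_six hoB, step_r_apply_six hoB,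
      step_r_apply_six hoB, step_r_apply_six hoB, if_pos rfl, if_neg hlm.symm, if_pos hb'mu, if_neg (Ne.symm hlu),
      if_neg (Ne.symm hlf), hrB4, h2, h3, h4, ite_self, ite_self, Finsupp.single_zero, Finsupp.single_zero, add_zero, add_zero]
  have hdivBp : ∀ d ∈ Bp.F.support, Bp.r ≤ d := forall_le_step_six hoB hdivB la hb'la
  have he3Bp : Module.finrank K (ResCone.resVertex Bp) = 3 := by
    rw [hEG A' Bp θ' e' U' E' (M - 5) (hθ'i la hlu hlf) (hθ'i mu hmu hmf) (he' la hlu hlf) (he' mu hmu hmf) hu0' hf0'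
      hdet' hU' hE' hrel' hrA' hrBp hdivA' hdivBp hoA' hoBp (by omega)]
    exact he3A'
  -- (8) (VT): the virtual translation is zero, the virtual child is the PURE step
  have hrow8 : ∀ d ∈ B.F.support, d.degree < 8 → ¬ (d u = 2 ∧ d f = 0) := fun d hd h8 => hrowB d hd (by omega)
  have hb'0 : b' = 0 := translation_eq_zero_of_frame hlm hlu hlf hmu hmf huf hoB hrB hdivB ha hformB hb'la hb'mu
    (by rw [← hBp]; exact hoBp) (by rw [← hBp]; exact he3Bp)
    (fun β h6 h3 => hVTu B β hrB hoB hdivB ⟨a, ha, hformB⟩ hledB hrow8 hVB h6 h3)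
  have hBp0 : Bp = CentreBlowup.step 5 Finset.univ la 0 B := by rw [hBp, hb'0]
  rw [hBp0] at hrel' hisoBp hoBp he3Bp
  -- (9) frame propagation
  obtain ⟨hrBp0, hdivBp0, hform', hled', hrow', hV'⟩ :=
    frame_step_zero hlm hlu hlf hmu hmf huf hoB hrB hdivB ha hformB hledB hrowB hVB hoBp he3Bp
  exact ⟨hbmu, hrA', θ', e', U', E', hθ'i la hlu hlf, hθ'i mu hmu hmf, he' la hlu hlf, he' mu hmu hmf, hu0', hf0', hdet',
    hU', hE', hrel', hoBp, hrBp0, hdivBp0, hform', hled', hrow', hV', hisoBp, he3Bp⟩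

/-! ## §2 One window step, rotation case -/

/-- **ONE STEP OF THE VIRTUAL WINDOW — ROTATION CASE.**  Slots `a` (translated away by the real step: `b (π a) ≠ 0`) and `a′`
(kept), free letters `{u, f} = {g, g̃}`; the REAL chain steps in the chart of the free letter `π g`.  The virtual partner steps
PURELY in the chart of the slot `a`, and the new bijection is `π′ = π ∘ (a g)`: `π′ a = π g` (the chart letter is the new real
slot), `π′ g = π a`.  Transport by `unitFrame_rotate₂` (Cramer: `exists_virtual_translation_rotate`; determinant:
`det_after_rotate`), then exactly as in the slot case. The foreign inputs `hVTu`, `hEG` are hypotheses BY VALUE (`hEG` now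
quantified over the bijection as well). [OURS] [cite: Hauser2010, §§F–G] [cite: CossartJannsenSaito2020, Thm. 3.14] -/
theorem virtual_step_rotate {π : Equiv.Perm (Fin 4)} {a a' u f g gt : Fin 4} (haa' : a ≠ a') (hau : a ≠ u) (haf : a ≠ f)
    (ha'u : a' ≠ u) (ha'f : a' ≠ f) (huf : u ≠ f) (hg : (g = u ∧ gt = f) ∨ (g = f ∧ gt = u))
    -- the relation at precision `M`
    {A B : State K} {θ e : Fin 4 → MvPolynomial (Fin 4) K} {U E : MvPolynomial (Fin 4) K} {M : ℕ}
    (hθa : θ (π a) = X a * e a) (hθa' : θ (π a') = X a' * e a') (hea : constantCoeff (e a) ≠ 0)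
    (hea' : constantCoeff (e a') ≠ 0) (hu0 : constantCoeff (θ (π u)) = 0) (hf0 : constantCoeff (θ (π f)) = 0)
    (hdet : coeff (Finsupp.single u 1) (θ (π u)) * coeff (Finsupp.single f 1) (θ (π f)) -
      coeff (Finsupp.single f 1) (θ (π u)) * coeff (Finsupp.single u 1) (θ (π f)) ≠ 0)
    (hU : constantCoeff U ≠ 0) (hE : E ∈ originIdeal K ^ M) (hrel : B.F = deletePthPowers 5 (U ^ 5 * aeval θ A.F) + E)
    -- the real state and its honest rotation step
    (hoA : ordZero A.F = 6) {A' : State K} {b : Fin 4 → K} (hbj : b (π g) = 0) (hba : b (π a) ≠ 0) (hba' : b (π a') = 0)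
    (hstep : A' = CentreBlowup.step 5 Finset.univ (π g) b A)
    (hisoA' : IsIsolated 5 A'.F) {Nc : ℕ} (hcert : originIdeal K ^ Nc ≤ singLocusIdeal 5 A'.F ⊔ originIdeal K ^ (Nc + 1))
    (hoA' : ordZero A'.F = 6) (he3A' : Module.finrank K (ResCone.resVertex A') = 3)
    (hrA' : A'.r = Finsupp.single (π g) 1 + Finsupp.single (π a') 1) (hdivA' : ∀ d ∈ A'.F.support, A'.r ≤ d)
    -- the virtual frame at jet `N`
    (hoB : ordZero B.F = 6) (hrB : B.r = Finsupp.single a 1 + Finsupp.single a' 1) (hdivB : ∀ d ∈ B.F.support, B.r ≤ d)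
    {aB : K} (haB : aB ≠ 0) (hformB : ResCone.resForm B = C aB * X f ^ 4)
    (hledB : ∀ e ∈ B.F.support, e f ≤ 3 → 2 ≤ e a ∧ 2 ≤ e a') {N : ℕ} (hN : 12 ≤ N)
    (hrowB : ∀ d ∈ B.F.support, d.degree < N → ¬ (d u = 2 ∧ d f = 0))
    (hVB : coeff (B.r + (Finsupp.single a 1 + Finsupp.single a' 1 + Finsupp.single u 3)) B.F ≠ 0)
    (hM : Nc + 12 ≤ M)
    -- (VT-u) two-state, BY VALUE (res-dim4-p-2 g5)
    (hVTu : ∀ (s : State K) (β : K), s.r = Finsupp.single a 1 + Finsupp.single a' 1 → ordZero s.F = 6 →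
      (∀ e ∈ s.F.support, s.r ≤ e) → (∃ c : K, c ≠ 0 ∧ ResCone.resForm s = C c * X f ^ 4) →
      (∀ e ∈ s.F.support, e f ≤ 3 → 2 ≤ e a ∧ 2 ≤ e a') →
      (∀ d ∈ s.F.support, d.degree < 8 → ¬ (d u = 2 ∧ d f = 0)) →
      coeff (s.r + (Finsupp.single a 1 + Finsupp.single a' 1 + Finsupp.single u 3)) s.F ≠ 0 →
      ordZero (CentreBlowup.step 5 Finset.univ a (Pi.single u β) s).F = 6 →
      Module.finrank K (ResCone.resVertex (CentreBlowup.step 5 Finset.univ a (Pi.single u β) s)) = 3 → β = 0)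
    -- `e_G` through the relation, BY VALUE (res-dim4-p-7 g4)
    (hEG : ∀ (π₁ : Equiv.Perm (Fin 4)) (A₁ B₁ : State K) (θ₁ e₁ : Fin 4 → MvPolynomial (Fin 4) K)
      (U₁ E₁ : MvPolynomial (Fin 4) K) (M₁ : ℕ),
      θ₁ (π₁ a) = X a * e₁ a → θ₁ (π₁ a') = X a' * e₁ a' → constantCoeff (e₁ a) ≠ 0 → constantCoeff (e₁ a') ≠ 0 →
      constantCoeff (θ₁ (π₁ u)) = 0 → constantCoeff (θ₁ (π₁ f)) = 0 →
      coeff (Finsupp.single u 1) (θ₁ (π₁ u)) * coeff (Finsupp.single f 1) (θ₁ (π₁ f)) -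
        coeff (Finsupp.single f 1) (θ₁ (π₁ u)) * coeff (Finsupp.single u 1) (θ₁ (π₁ f)) ≠ 0 →
      constantCoeff U₁ ≠ 0 → E₁ ∈ originIdeal K ^ M₁ → B₁.F = deletePthPowers 5 (U₁ ^ 5 * aeval θ₁ A₁.F) + E₁ →
      A₁.r = Finsupp.single (π₁ a) 1 + Finsupp.single (π₁ a') 1 → B₁.r = Finsupp.single a 1 + Finsupp.single a' 1 →
      (∀ d ∈ A₁.F.support, A₁.r ≤ d) → (∀ d ∈ B₁.F.support, B₁.r ≤ d) → ordZero A₁.F = 6 → ordZero B₁.F = 6 → 6 < M₁ →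
      Module.finrank K (ResCone.resVertex B₁) = Module.finrank K (ResCone.resVertex A₁)) :
    ∃ (π' : Equiv.Perm (Fin 4)) (θ' e' : Fin 4 → MvPolynomial (Fin 4) K) (U' E' : MvPolynomial (Fin 4) K),
      π' = (Equiv.swap a g).trans π ∧ π' a = π g ∧ π' a' = π a' ∧ π' g = π a ∧ π' gt = π gt ∧
      θ' (π' a) = X a * e' a ∧ θ' (π' a') = X a' * e' a' ∧ constantCoeff (e' a) ≠ 0 ∧ constantCoeff (e' a') ≠ 0 ∧
      constantCoeff (θ' (π' u)) = 0 ∧ constantCoeff (θ' (π' f)) = 0 ∧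
      coeff (Finsupp.single u 1) (θ' (π' u)) * coeff (Finsupp.single f 1) (θ' (π' f)) -
        coeff (Finsupp.single f 1) (θ' (π' u)) * coeff (Finsupp.single u 1) (θ' (π' f)) ≠ 0 ∧
      constantCoeff U' ≠ 0 ∧ E' ∈ originIdeal K ^ (M - 5) ∧
      (CentreBlowup.step 5 Finset.univ a 0 B).F = deletePthPowers 5 (U' ^ 5 * aeval θ' A'.F) + E' ∧
      -- the frame of the virtual child at jet `N − 4`
      ordZero (CentreBlowup.step 5 Finset.univ a 0 B).F = 6 ∧
      (CentreBlowup.step 5 Finset.univ a 0 B).r = Finsupp.single a 1 + Finsupp.single a' 1 ∧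
      (∀ d ∈ (CentreBlowup.step 5 Finset.univ a 0 B).F.support, (CentreBlowup.step 5 Finset.univ a 0 B).r ≤ d) ∧
      (∃ c : K, c ≠ 0 ∧ ResCone.resForm (CentreBlowup.step 5 Finset.univ a 0 B) = C c * X f ^ 4) ∧
      (∀ e ∈ (CentreBlowup.step 5 Finset.univ a 0 B).F.support, e f ≤ 3 → 2 ≤ e a ∧ 2 ≤ e a') ∧
      (∀ d ∈ (CentreBlowup.step 5 Finset.univ a 0 B).F.support, d.degree < N - 4 → ¬ (d u = 2 ∧ d f = 0)) ∧
      coeff ((CentreBlowup.step 5 Finset.univ a 0 B).r + (Finsupp.single a 1 + Finsupp.single a' 1 + Finsupp.single u 3))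
        (CentreBlowup.step 5 Finset.univ a 0 B).F ≠ 0 ∧
      IsIsolated 5 (CentreBlowup.step 5 Finset.univ a 0 B).F ∧
      Module.finrank K (ResCone.resVertex (CentreBlowup.step 5 Finset.univ a 0 B)) = 3 := by
  haveI : Fact (Nat.Prime 5) := ⟨by norm_num⟩
  have _ := hN
  -- (1) the free letters `g, g̃`
  have hag : a ≠ g := by rcases hg with ⟨rfl, -⟩ | ⟨rfl, -⟩ <;> assumption
  have hagt : a ≠ gt := by rcases hg with ⟨-, rfl⟩ | ⟨-, rfl⟩ <;> assumption
  have ha'g : a' ≠ g := by rcases hg with ⟨rfl, -⟩ | ⟨rfl, -⟩ <;> assumption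
  have ha'gt : a' ≠ gt := by rcases hg with ⟨-, rfl⟩ | ⟨-, rfl⟩ <;> assumption
  have hggt : g ≠ gt := by
    rcases hg with ⟨rfl, rfl⟩ | ⟨rfl, rfl⟩
    · exact huf
    · exact huf.symm
  have hg0 : constantCoeff (θ (π g)) = 0 := by rcases hg with ⟨rfl, -⟩ | ⟨rfl, -⟩ <;> assumption
  have hgt0 : constantCoeff (θ (π gt)) = 0 := by rcases hg with ⟨-, rfl⟩ | ⟨-, rfl⟩ <;> assumption
  have hdetg : coeff (Finsupp.single g 1) (θ (π g)) * coeff (Finsupp.single gt 1) (θ (π gt)) -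
      coeff (Finsupp.single gt 1) (θ (π g)) * coeff (Finsupp.single g 1) (θ (π gt)) ≠ 0 := by
    rcases hg with ⟨rfl, rfl⟩ | ⟨rfl, rfl⟩
    · exact hdet
    · exact fun h => hdet (by linear_combination h)
  have hA5 : ((5 : ℕ) : ℕ∞) ≤ ordAlong Finset.univ A.F := by rw [ordAlong_univ, hoA]; exact_mod_cast (by norm_num : 5 ≤ 6)
  have hB5 : ((5 : ℕ) : ℕ∞) ≤ ordAlong Finset.univ B.F := by rw [ordAlong_univ, hoB]; exact_mod_cast (by norm_num : 5 ≤ 6)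
  -- (2) Cramer: the virtual translation and the rescaling `λ`
  obtain ⟨lam, b', hb'a, hb'a', hLa, hLg, hLgt⟩ :=
    exists_virtual_translation_rotate (π := π) (θ := θ) (e := e) hag hagt ha'g ha'gt hggt b hba hdetg
  have hlam : lam ≠ 0 := by
    intro h; rw [h, zero_mul] at hLa; exact hea hLa.symm
  -- (3) transport across the two charts
  obtain ⟨θ', e', U', E', hθ'g, hθ'a', he'a, he'a', ha0', hgt0', hU', hE', hrel', -, -, htana, htangt⟩ :=
    unitFrame_rotate₂ 5 π haa' hag hagt ha'g ha'gt hggt (M := M) (by omega) hθa hθa' hea hea' hg0 hgt0 hU hE hrel hA5 hB5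
      hbj hba' hb'a hb'a' hLa hLg hLgt
  rw [← hstep] at hrel'
  -- (4) the new free block is invertible
  have hD'g : coeff (Finsupp.single g 1) (θ' (π a)) * coeff (Finsupp.single gt 1) (θ' (π gt)) -
      coeff (Finsupp.single gt 1) (θ' (π a)) * coeff (Finsupp.single g 1) (θ' (π gt)) ≠ 0 := by
    intro h0
    have h := det_after_rotate hag hagt (σ := b (π gt)) hlam htana htangt
    rw [h0, mul_zero] at h
    exact mul_ne_zero hea hdetg (neg_eq_zero.mp h.symm)
  -- (5) the new bijection `π′ = π ∘ (a g)`
  obtain ⟨π', hπ'⟩ : ∃ π' : Equiv.Perm (Fin 4), π' = (Equiv.swap a g).trans π := ⟨_, rfl⟩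
  have hπ'a : π' a = π g := by rw [hπ', Equiv.trans_apply, Equiv.swap_apply_left]
  have hπ'g : π' g = π a := by rw [hπ', Equiv.trans_apply, Equiv.swap_apply_right]
  have hπ'a' : π' a' = π a' := by rw [hπ', Equiv.trans_apply, Equiv.swap_apply_of_ne_of_ne haa'.symm ha'g]
  have hπ'gt : π' gt = π gt := by rw [hπ', Equiv.trans_apply, Equiv.swap_apply_of_ne_of_ne hagt.symm hggt.symm]
  have hθn : θ' (π' a) = X a * e' a := by rw [hπ'a]; exact hθ'g
  have hθn' : θ' (π' a') = X a' * e' a' := by rw [hπ'a']; exact hθ'a'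
  have hu0n : constantCoeff (θ' (π' u)) = 0 := by
    rcases hg with ⟨rfl, rfl⟩ | ⟨rfl, rfl⟩
    · rw [hπ'g]; exact ha0'
    · rw [hπ'gt]; exact hgt0'
  have hf0n : constantCoeff (θ' (π' f)) = 0 := by
    rcases hg with ⟨rfl, rfl⟩ | ⟨rfl, rfl⟩
    · rw [hπ'gt]; exact hgt0'
    · rw [hπ'g]; exact ha0'
  have hdetn : coeff (Finsupp.single u 1) (θ' (π' u)) * coeff (Finsupp.single f 1) (θ' (π' f)) -
      coeff (Finsupp.single f 1) (θ' (π' u)) * coeff (Finsupp.single u 1) (θ' (π' f)) ≠ 0 := by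
    rcases hg with ⟨rfl, rfl⟩ | ⟨rfl, rfl⟩
    · rw [hπ'g, hπ'gt]; exact hD'g
    · rw [hπ'g, hπ'gt]; exact fun h => hD'g (by linear_combination h)
  have hrAn : A'.r = Finsupp.single (π' a) 1 + Finsupp.single (π' a') 1 := by rw [hπ'a, hπ'a']; exact hrA'
  -- (6) order and isolation of the virtual child
  set Bp := CentreBlowup.step 5 Finset.univ a b' B with hBp
  have hread := read_of_rel₂ 5 haa' hau haf ha'u ha'f huf hθn hθn' he'a he'a' hu0n hf0n hdetn hU' hE' hrel' hisoA' hcert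
    (by omega) (o := 6) hoA' (by norm_num) (by omega)
  have hisoBp : IsIsolated 5 Bp.F := hread.1
  have hoBp : ordZero Bp.F = 6 := by exact_mod_cast hread.2
  -- (7) ledger and divisibility of the virtual child, then `e_G` by value
  have hrBp : Bp.r = Finsupp.single a 1 + Finsupp.single a' 1 := by
    obtain ⟨-, h2, h3, h4⟩ := ResCone.quad_apply haa' hau haf ha'u ha'f huf 1 1 0 0
    have hrB4 : B.r = Finsupp.single a 1 + Finsupp.single a' 1 + Finsupp.single u 0 + Finsupp.single f 0 := by
      rw [hrB, Finsupp.single_zero, Finsupp.single_zero, add_zero, add_zero]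
    rw [ResCone.eq_sum_single_four haa' hau haf ha'u ha'f huf Bp.r, hBp, step_r_apply_six hoB, step_r_apply_six hoB,
      step_r_apply_six hoB, step_r_apply_six hoB, if_pos rfl, if_neg haa'.symm, if_pos hb'a', if_neg (Ne.symm hau),
      if_neg (Ne.symm haf), hrB4, h2, h3, h4, ite_self, ite_self, Finsupp.single_zero, Finsupp.single_zero, add_zero, add_zero]
  have hdivBp : ∀ d ∈ Bp.F.support, Bp.r ≤ d := forall_le_step_six hoB hdivB a hb'a
  have he3Bp : Module.finrank K (ResCone.resVertex Bp) = 3 := by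
    rw [hEG π' A' Bp θ' e' U' E' (M - 5) hθn hθn' he'a he'a' hu0n hf0n hdetn hU' hE' hrel' hrAn hrBp hdivA' hdivBp hoA'
      hoBp (by omega)]
    exact he3A'
  -- (8) (VT): the virtual translation is zero, the virtual child is the PURE step
  have hrow8 : ∀ d ∈ B.F.support, d.degree < 8 → ¬ (d u = 2 ∧ d f = 0) := fun d hd h8 => hrowB d hd (by omega)
  have hb'0 : b' = 0 := translation_eq_zero_of_frame haa' hau haf ha'u ha'f huf hoB hrB hdivB haB hformB hb'a hb'a'
    (by rw [← hBp]; exact hoBp) (by rw [← hBp]; exact he3Bp)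
    (fun β h6 h3 => hVTu B β hrB hoB hdivB ⟨aB, haB, hformB⟩ hledB hrow8 hVB h6 h3)
  have hBp0 : Bp = CentreBlowup.step 5 Finset.univ a 0 B := by rw [hBp, hb'0]
  rw [hBp0] at hrel' hisoBp hoBp he3Bp
  -- (9) frame propagation
  obtain ⟨hrBp0, hdivBp0, hform', hled', hrow', hV'⟩ :=
    frame_step_zero haa' hau haf ha'u ha'f huf hoB hrB hdivB haB hformB hledB hrowB hVB hoBp he3Bp
  exact ⟨π', θ', e', U', E', hπ', hπ'a, hπ'a', hπ'g, hπ'gt, hθn, hθn', he'a, he'a', hu0n, hf0n, hdetn, hU', hE', hrel', hoBp, hrBp0,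
    hdivBp0, hform', hled', hrow', hV', hisoBp, he3Bp⟩

end SwapTransport

end Summit.ResolutionOfSingularities.ResolutionOfSingularities.Theorems.PIDim4

end
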